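import Summits.BirchSwinnertonDyer.Rank1Residual.GaloisImage.KolyvaginComparisonOperatorTorsion
import Summits.BirchSwinnertonDyer.Rank1Residual.GaloisImage.SakamotoN11Instance
import Summits.BirchSwinnertonDyer.Rank1Residual.GaloisImage.CyclotomicLevelPTowerFrobenius
import Summits.BirchSwinnertonDyer.Rank1Residual.GaloisImage.KolyvaginPrimeFlagLevelOne
import Literature.NumberTheory.EllipticCurves.ModularityVersionApProofs
import Literature.NumberTheory.GaloisCohomology.KolyvaginSystems
import Mathlib.LinearAlgebra.Eigenspace.Charpoly
import HarnessLib

/-!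
# The canonical `τ`-class primes on `E[3]` are Kolyvagin primes of level one
# (located sub-item E1 of ROW T-PK6-M1-END; cell `b2b-bsdres`, team n1011, seat p13 GEN 13)

HONEST FRAMING (cell `b2b-bsdres`, run/shared/lean/b2b/bsd-rank1-residual/, verbatim in every
file): the goal of the cell is to DELETE the COMBINATION-SHAPED residual classes of the
Birch–Swinnerton-Dyer formula for ALL analytic-rank `≤ 1` elliptic curves over `ℚ` — "full BSD
formula for every rank `≤ 1` curve in class `C`" assembled STRICTLY from published theorems — so
that the rank-`≤ 1` remainder becomes exactly the CONSTRUCTION-SHAPED classes, which are TYPED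
(missing-input `Prop`s), NOT attempted. This is not "finishing BSD". Team n1011: research route on
the CONSTRUCTION-SHAPED class X4 / §I N11 (route-1 PORT).  TOOL theorem (no definition, no named
fact, no `sorry`); nothing is booked; no mark / label / count moves.

## What, and why

THEOREM D of row T-DER (`Derivative.Rat.exists_isKolyvaginSystem_propagatedSelmerStructure*`,
n1011-p11) asks that every prime of the Kolyvagin datum be a Kolyvagin prime of the relevant level
(`hKol : ∀ ℓ ∈ D.primes, Kato.IsKolyvaginPrime W p (k+1) ℓ`), while the ENDs of record pin
`D.primes = frobeniusClassPrimes (E[3]) S τ 3` (the Chebotarev class of Sakamoto's `τ`).  This file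
proves the implication at `p = 3`, level `1`:
`isKolyvaginPrime_one_of_mem_frobeniusClassPrimes` — for `τ ∈ rootsOfUnityFixer ℚ 3` with
`cokerSubOne (E[3]) τ ≃ ℤ/3` and `S ⊇` the bad places, every `v ∈ frobeniusClassPrimes (E[3]) S τ 3`
has `Kato.IsKolyvaginPrime W 3 1 ℓ_v` (`ℓ ∤ 3N_E`, `ℓ ≡ 1 (3)`, `a_ℓ ≡ ℓ + 1 (3)`).  Ingredients
(all in the tree): n1011-p13 GEN 12's `TorsionComparison.charpoly_zmodEnd_torsion_frobenius`
(Frobenius characteristic polynomial on `E[p^n]`), `CyclotomicLevel.Rat.pow_mem_rootsOfUnityFixer_iff_of_isArithFrobAtPlace`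
(Frobenius fixes `μ_n` iff `ℓ ≡ 1`), Mathlib's `Module.End.hasEigenvalue_iff_isRoot_charpoly` and
`LinearMap.injective_iff_surjective` on the `𝔽₃`-plane `E[3]` (the `ℤ/3`-module instances of
`SakamotoN11Instance` at depth `0`, read on `E[3^1]` by evaluation), `dvd_conductorNorm_iff`.
No Weil pairing / determinant argument is needed: `1` is a root of `X² − a_ℓX + ℓ` directly.
Consumer: ROW T-PK6-M1-END (`KolyvaginLevelOneUnitCaseOfZetaBody`), where it removes the displayed
binder `hKol`.
References: R. Sakamoto, JTNB 36 (2024) §2 [Sakamoto2024]; C.-H. Kim, AJM 148 (2026) §1.2.2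
[Kim2022StructureSelmer]; J. H. Silverman, *AEC* V.2.3, VII.7.1 [SilvermanAEC2009].
-/

noncomputable section

open scoped Classical NumberField
open Polynomial Field NumberField IsDedekindDomain
open WeierstrassCurve Literature.NumberTheory.EllipticCurves Literature.NumberTheory.GaloisRepresentations
  Literature.NumberTheory.GaloisRepresentations.DiscreteGaloisModule Literature.NumberTheory.GaloisCohomology
open Rat.HeightOneSpectrum

namespace Summit.BirchSwinnertonDyer.Rank1Residual.GaloisImage.KolyvaginPrime

open Summit.BirchSwinnertonDyer.Rank1Residual.GaloisImage

variable (W : WeierstrassCurve ℚ) [W.IsElliptic] [W.IsGloballyMinimal]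

set_option backward.isDefEq.respectTransparency false in
/-- **Every prime of the canonical `τ`-class on `E[3]` is a Kolyvagin prime of level `1`.**  For
`τ ∈ Gal(ℚ̄/ℚ(μ₃))` with `E[3]/(τ − 1) ≅ ℤ/3` (Sakamoto's (H.2) datum) and a finite place
`v ∈ frobeniusClassPrimes (E[3]) S τ 3` (`v ∉ S ⊇` the bad places, `v ∤ 3`, a Frobenius `σ` at `v`
with `ρ(σ) = ρ(τ)` on `E[3]` and `σ ≡ τ` on `μ₃`): the prime `ℓ` of `v` satisfies `ℓ ∤ 3N_E`,
`ℓ ≡ 1 (mod 3)` (`σ` fixes `μ₃`; the tree's `pow_mem_rootsOfUnityFixer_iff_of_isArithFrobAtPlace`)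
and `a_ℓ ≡ ℓ + 1 (mod 3)` — because `charpoly(σ | E[3]) = X² − a_ℓX + ℓ`
(`TorsionComparison.charpoly_zmodEnd_torsion_frobenius`) equals `charpoly(τ | E[3])`, and `1` is a
root of the latter: `τ − 1` is not onto (its cokernel is `ℤ/3`), hence not injective on the
`𝔽₃`-plane `E[3]`.  The converse direction is n1011-p18's `mem_frobeniusClassPrimes_of_kolyvaginPrime`.
[cite: Sakamoto2024, §2 (H.2) and the set 𝒫 (pp. 920–921)] [cite: Kim2022StructureSelmer, §1.2.2]
[cite: SilvermanAEC2009, Prop. V.2.3 and Thm. VII.7.1] -/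
theorem isKolyvaginPrime_one_of_mem_frobeniusClassPrimes
    {S : Set (HeightOneSpectrum (𝓞 ℚ))} (hSbad : ∀ v ∉ S, W.HasGoodReductionAt v)
    {τ : absoluteGaloisGroup ℚ} (hτμ : τ ∈ rootsOfUnityFixer ℚ 3)
    (hτq : Nonempty (cokerSubOne (W.torsionGaloisModule ((3 : ℕ) : ℤ)) τ ≃+ ZMod 3))
    {v : HeightOneSpectrum (𝓞 ℚ)}
    (hv : v ∈ frobeniusClassPrimes (W.torsionGaloisModule ((3 : ℕ) : ℤ)) S τ 3) :
    Kato.IsKolyvaginPrime W 3 1 ((primesEquiv v : Nat.Primes) : ℕ) := by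
  have h01 : (0 : ZMod 3) ≠ 1 := by decide
  obtain ⟨hvS, hv3, -, σ, hσ, hρ, hζ⟩ := hv
  have hℓ : ((primesEquiv v : Nat.Primes) : ℕ).Prime := (primesEquiv v).2
  have hgood : W.HasGoodReductionAt v := hSbad v hvS
  have hℓ3 : ((primesEquiv v : Nat.Primes) : ℕ) ≠ 3 := fun h =>
    hv3 (KolyvaginPrime.natCast_mem_asIdeal_of_primesEquiv_eq h)
  have hn : ¬ ((primesEquiv v : Nat.Primes) : ℕ) ∣ 3 := fun h =>
    hℓ3 ((Nat.prime_dvd_prime_iff_eq hℓ Nat.prime_three).mp h)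
  -- (1) `σ` fixes `μ₃`, hence `ℓ ≡ 1 (mod 3)`
  have hσμ : σ ∈ rootsOfUnityFixer ℚ 3 := by
    intro t ht
    have h1 := hζ t ht
    have h2 := hτμ t ht
    calc σ • t = (σ * τ⁻¹ * τ) • t := by rw [inv_mul_cancel_right]
      _ = (σ * τ⁻¹) • (τ • t) := mul_smul _ _ _
      _ = t := by rw [h2, h1]
  have hℓ1 : ((primesEquiv v : Nat.Primes) : ℕ) ≡ 1 [MOD 3] := by
    have := (CyclotomicLevel.Rat.pow_mem_rootsOfUnityFixer_iff_of_isArithFrobAtPlace hn hσ 1).mp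
      (by rwa [pow_one])
    rwa [pow_one] at this
  -- (2) the trace: `ρ σ = ρ τ` on `E[3]`, `τ − 1` not onto ⇒ `1` is a root of `X² − a_ℓ X + ℓ`
  -- instances on `E[3]` read as `E[3^0·3]` / `E[3^1]` (same type by evaluation)
  letI instM : Module (ZMod (3 ^ 1)) (geomTorsion W ((3 ^ 1 : ℕ) : ℤ)) :=
    instModuleZModGeomTorsionPowMul W 3 0
  letI instFin : Module.Finite (ZMod (3 ^ 1)) (geomTorsion W ((3 ^ 1 : ℕ) : ℤ)) :=
    instModuleFiniteZModGeomTorsionPowMul W 3 0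
  letI instFree : Module.Free (ZMod (3 ^ 1)) (geomTorsion W ((3 ^ 1 : ℕ) : ℤ)) :=
    instModuleFreeZModGeomTorsionPowMul W 3 0
  haveI : Fact (Nat.Prime (3 ^ 1)) := ⟨by norm_num⟩
  have hchar := TorsionComparison.charpoly_zmodEnd_torsion_frobenius W 3 1 hℓ3 hgood hσ
  -- `ρ σ = ρ τ`
  have hστ : ∀ m : geomTorsion W ((3 ^ 1 : ℕ) : ℤ),
      W.torsionGaloisModule ((3 ^ 1 : ℕ) : ℤ) σ m = W.torsionGaloisModule ((3 ^ 1 : ℕ) : ℤ) τ m := by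
    intro m
    have h := hρ (W.torsionGaloisModule ((3 : ℕ) : ℤ) τ m)
    rw [torsionGaloisModule_apply_apply, torsionGaloisModule_apply_apply, mul_smul,
      inv_smul_smul] at h
    exact h
  have hend : (W.torsionGaloisModule ((3 ^ 1 : ℕ) : ℤ)).zmodEnd (3 ^ 1) σ =
      (W.torsionGaloisModule ((3 ^ 1 : ℕ) : ℤ)).zmodEnd (3 ^ 1) τ := by
    apply LinearMap.ext
    intro m
    rw [zmodEnd_apply, zmodEnd_apply]
    exact hστ m
  -- `τ − 1` is not surjective on `E[3]` (its cokernel is `ℤ/3`)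
  rw [hend] at hchar
  have hnsurj : ¬ Function.Surjective
      (((W.torsionGaloisModule ((3 ^ 1 : ℕ) : ℤ)).zmodEnd (3 ^ 1) τ - 1 :
          Module.End (ZMod (3 ^ 1)) (geomTorsion W ((3 ^ 1 : ℕ) : ℤ))) :
        geomTorsion W ((3 ^ 1 : ℕ) : ℤ) → geomTorsion W ((3 ^ 1 : ℕ) : ℤ)) := by
    intro hs
    obtain ⟨e⟩ := hτq
    -- the range of `ρ τ − id` is everything, so the cokernel is trivial
    have hrange : ((W.torsionGaloisModule ((3 : ℕ) : ℤ) τ).toAddMonoidHom -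
        AddMonoidHom.id _).range = ⊤ := by
      rw [AddMonoidHom.range_eq_top]
      intro y
      obtain ⟨x, hx⟩ := hs y
      exact ⟨x, hx⟩
    have hsub : Subsingleton (cokerSubOne (W.torsionGaloisModule ((3 : ℕ) : ℤ)) τ) := by
      rw [cokerSubOne, hrange]
      exact QuotientAddGroup.subsingleton_quotient_top
    haveI := hsub
    have : Subsingleton (ZMod 3) := e.symm.subsingleton
    exact h01 (Subsingleton.elim (0 : ZMod 3) 1)
  have hker : LinearMap.ker ((W.torsionGaloisModule ((3 ^ 1 : ℕ) : ℤ)).zmodEnd (3 ^ 1) τ - 1 :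
      Module.End (ZMod (3 ^ 1)) (geomTorsion W ((3 ^ 1 : ℕ) : ℤ))) ≠ ⊥ := by
    intro hk
    exact hnsurj (LinearMap.injective_iff_surjective.mp (LinearMap.ker_eq_bot.mp hk))
  have heig : ((W.torsionGaloisModule ((3 ^ 1 : ℕ) : ℤ)).zmodEnd (3 ^ 1) τ).HasEigenvalue 1 := by
    rw [Module.End.hasEigenvalue_iff, Module.End.eigenspace_def, one_smul]
    exact hker
  have hroot := (Module.End.hasEigenvalue_iff_isRoot_charpoly _ 1).mp heig
  rw [hchar] at hroot
  -- read off `1 − a_ℓ + ℓ = 0` in `ℤ/3`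
  have heval : (1 : ZMod (3 ^ 1)) - ((W.frobeniusTrace (primesEquiv v) : ℤ) : ZMod (3 ^ 1)) +
      ((((primesEquiv v : Nat.Primes) : ℕ) : ℕ) : ZMod (3 ^ 1)) = 0 := by
    have h := hroot
    simp only [Polynomial.IsRoot.def, eval_add, eval_sub, eval_pow, eval_X, eval_mul, eval_C,
      one_pow, mul_one] at h
    exact h
  refine ⟨hℓ, ?_, hℓ1, ?_⟩
  · -- `ℓ ∤ N_W · 3`
    intro hdvd
    rcases (Nat.Prime.dvd_mul hℓ).mp hdvd with h | h
    · exact ((W.dvd_conductorNorm_iff v).mp h) hgood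
    · exact hn h
  · -- `a_ℓ ≡ ℓ + 1 (mod 3)`
    refine (ZMod.intCast_eq_intCast_iff _ _ (3 ^ 1)).mp ?_
    push_cast
    linear_combination -heval

end Summit.BirchSwinnertonDyer.Rank1Residual.GaloisImage.KolyvaginPrime

end
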